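import Summits.MatrixMultiplication.OmegaCensus.STPPSmallPatternKernelSearchX2
import Summits.MatrixMultiplication.OmegaCensus.STPPSmallPatternKernelProduct
import Summits.MatrixMultiplication.OmegaCensus.STPPSmallPatternNone211K6P2x2x6Part1
import Summits.MatrixMultiplication.OmegaCensus.STPPSmallPatternNone211K6P2x2x6Part2
import Summits.MatrixMultiplication.OmegaCensus.STPPSmallPatternNone211K6P2x2x6Part3
import Summits.MatrixMultiplication.OmegaCensus.STPPSmallPatternNone211K6P2x2x6Part4
import Summits.MatrixMultiplication.OmegaCensus.STPPSmallPatternNone211K6P2x2x6Part5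
import Summits.MatrixMultiplication.OmegaCensus.STPPSmallPatternNone211K6P2x2x6Part6
import Summits.MatrixMultiplication.OmegaCensus.STPPSmallPatternNone211K6P2x2x6Part7
import Summits.MatrixMultiplication.OmegaCensus.STPPSmallPatternNone211K6P2x2x6Part8
import Summits.MatrixMultiplication.OmegaCensus.STPPSmallPatternNone211K6P2x2x6Part9

/-!
# ω-census, `(2,1,1)^6` is infeasible in `ℤ/2 × ℤ/2 × ℤ/6` (kernel theorem)

HONEST FRAMING (pub-omega census; verbatim): lottery ticket; floor = certified bounds/negative ranges.
Census STRUCTURE bookkeeping of the STPP track (seat pub-omega-eng2 = ENG2, gen 33, on the kernel engine + reflection of seat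
pub-omega-stpp-3 gen 23; STRUCTURE row B5, the threshold column `T1(H) = max {k : (2,1,1)^k ⊆ H}`, lower side of the
`k = 6` ORDER LAW `(2,1,1)⁶ ⊆ G ↔ 30 ≤ |G|`), not progress on `ω`: small patterns in small groups bound no exponent.

The kernel mask search `STPP211Neg.search2` (two-level chunks, `STPPSmallPatternKernelSearchX2.lean`) on `prodGC 2 (prodGC 2 (zcode 6))` over the chunks of the
9 part files returns `true` (`decide +kernel`, 22 chunk theorems, 11864525 mask translations ≈ 1528 s of kernel time);
the chunks of every representative cover every PAIR of codes; every nonzero `d` is carried into the representative list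
by an automorphism from the listed generators (`GL₃(𝔽₂)` transvections through `fst`/`snd`/`ZMod.castHom 6 → 2`/`ZMod.lift 2 → 6`, the unit `5` on `ℤ/6`) (kernel decisions); `STPP211Neg.not_exists_isSTPP_211_of_search2` turns this into:
**no `A B C : Fin 6 → Finset (ZMod 2 × (ZMod 2 × ZMod 6))` with `IsSTPP A B C` (CKSU Def. 5.1, tree `IsSTPP`) and `|Aᵢ| = 2`, `|Bᵢ| = |Cᵢ| = 1.**

References: H. Cohn, R. Kleinberg, B. Szegedy, C. Umans, FOCS 2005 (arXiv:math/0511460), Def. 5.1.  Record: pub-omega HOME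
`pub-omega-eng2-g33/results/none6/` (ENG2's C mirror `k211c.c` of the kernel tree — validated against stpp-3's Python mirror
`k211v3.py` on the landed `k = 5` cells to the translation count — gives COMPLETE NONE on this cell with 11864525 mask
translations; per-`(d,c₁,c₂)` cost tables, planner `plan6.py`; farm calibration 129 µs per translation; not used by the proofs).
-/

open Literature.Computability.AlgebraicComplexity

set_option Elab.async false  -- several kernel pieces: elaborate sequentially (memory)

namespace Summit.MatrixMultiplication.OmegaCensus

namespace STPP211Neg

/-- All chunks of `ℤ/2 × ℤ/2 × ℤ/6`, `k = 6` (the parts' lists). -/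
def P2_2_6k6.chunks : List (ℕ × ℕ × ℕ) :=
  P2_2_6k6.part1 ++ P2_2_6k6.part2 ++ P2_2_6k6.part3 ++ P2_2_6k6.part4 ++ P2_2_6k6.part5 ++ P2_2_6k6.part6 ++ P2_2_6k6.part7 ++ P2_2_6k6.part8 ++ P2_2_6k6.part9

/-- The kernel search over all chunks of `ℤ/2 × ℤ/2 × ℤ/6`, `k = 6` (assembled from the parts). -/
theorem P2_2_6k6.search_all : search2 (prodGC 2 (prodGC 2 (zcode 6))) 6 P2_2_6k6.chunks = true := by
  simp only [P2_2_6k6.chunks, search2_append, P2_2_6k6.ps1, P2_2_6k6.ps2, P2_2_6k6.ps3, P2_2_6k6.ps4, P2_2_6k6.ps5, P2_2_6k6.ps6, P2_2_6k6.ps7, P2_2_6k6.ps8, P2_2_6k6.ps9, Bool.and_self]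

/-- Representative codes of `ℤ/2 × ℤ/2 × ℤ/6` `∖ 0` (one per orbit of `Aut(ℤ/2 × ℤ/2 × ℤ/6) ≅ GL₃(𝔽₂) × 𝔽₃ˣ` on the nonzero elements (3 orbits)). -/
def P2_2_6k6.reps : List ℕ :=
  [1, 2, 3]

/-- Automorphisms (coordinate swap, transvections, the unit of `ℤ/6`, and composites) of `ℤ/2 × ℤ/2 × ℤ/6`. -/
def P2_2_6k6.auts : List (ZMod 2 × (ZMod 2 × ZMod 6) →+ ZMod 2 × (ZMod 2 × ZMod 6)) :=
  [AddMonoidHom.mulLeft (((1 : ZMod 2), ((1 : ZMod 2), (1 : ZMod 6))) : ZMod 2 × (ZMod 2 × ZMod 6)),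
    AddMonoidHom.mulLeft (((1 : ZMod 2), ((1 : ZMod 2), (5 : ZMod 6))) : ZMod 2 × (ZMod 2 × ZMod 6)),
    ((AddMonoidHom.fst (ZMod 2) (ZMod 2 × ZMod 6)) + ((ZMod.castHom (show 2 ∣ 6 by norm_num) (ZMod 2)).toAddMonoidHom).comp ((AddMonoidHom.snd (ZMod 2) (ZMod 6)).comp (AddMonoidHom.snd (ZMod 2) (ZMod 2 × ZMod 6)))).prod (((AddMonoidHom.fst (ZMod 2) (ZMod 6)).comp (AddMonoidHom.snd (ZMod 2) (ZMod 2 × ZMod 6))).prod ((AddMonoidHom.snd (ZMod 2) (ZMod 6)).comp (AddMonoidHom.snd (ZMod 2) (ZMod 2 × ZMod 6)))),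
    (((AddMonoidHom.fst (ZMod 2) (ZMod 2 × ZMod 6)) + ((ZMod.castHom (show 2 ∣ 6 by norm_num) (ZMod 2)).toAddMonoidHom).comp ((AddMonoidHom.snd (ZMod 2) (ZMod 6)).comp (AddMonoidHom.snd (ZMod 2) (ZMod 2 × ZMod 6)))).prod (((AddMonoidHom.fst (ZMod 2) (ZMod 6)).comp (AddMonoidHom.snd (ZMod 2) (ZMod 2 × ZMod 6))).prod ((AddMonoidHom.snd (ZMod 2) (ZMod 6)).comp (AddMonoidHom.snd (ZMod 2) (ZMod 2 × ZMod 6))))).comp (AddMonoidHom.mulLeft (((1 : ZMod 2), ((1 : ZMod 2), (5 : ZMod 6))) : ZMod 2 × (ZMod 2 × ZMod 6))),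
    (((AddMonoidHom.fst (ZMod 2) (ZMod 2 × ZMod 6)) + ((ZMod.castHom (show 2 ∣ 6 by norm_num) (ZMod 2)).toAddMonoidHom).comp ((AddMonoidHom.snd (ZMod 2) (ZMod 6)).comp (AddMonoidHom.snd (ZMod 2) (ZMod 2 × ZMod 6)))).prod (((AddMonoidHom.fst (ZMod 2) (ZMod 6)).comp (AddMonoidHom.snd (ZMod 2) (ZMod 2 × ZMod 6))).prod ((AddMonoidHom.snd (ZMod 2) (ZMod 6)).comp (AddMonoidHom.snd (ZMod 2) (ZMod 2 × ZMod 6))))).comp (((AddMonoidHom.fst (ZMod 2) (ZMod 6)).comp (AddMonoidHom.snd (ZMod 2) (ZMod 2 × ZMod 6))).prod ((AddMonoidHom.fst (ZMod 2) (ZMod 2 × ZMod 6)).prod ((AddMonoidHom.snd (ZMod 2) (ZMod 6)).comp (AddMonoidHom.snd (ZMod 2) (ZMod 2 × ZMod 6))))),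
    (((AddMonoidHom.fst (ZMod 2) (ZMod 2 × ZMod 6)) + ((ZMod.castHom (show 2 ∣ 6 by norm_num) (ZMod 2)).toAddMonoidHom).comp ((AddMonoidHom.snd (ZMod 2) (ZMod 6)).comp (AddMonoidHom.snd (ZMod 2) (ZMod 2 × ZMod 6)))).prod (((AddMonoidHom.fst (ZMod 2) (ZMod 6)).comp (AddMonoidHom.snd (ZMod 2) (ZMod 2 × ZMod 6))).prod ((AddMonoidHom.snd (ZMod 2) (ZMod 6)).comp (AddMonoidHom.snd (ZMod 2) (ZMod 2 × ZMod 6))))).comp ((AddMonoidHom.fst (ZMod 2) (ZMod 2 × ZMod 6)).prod (((AddMonoidHom.fst (ZMod 2) (ZMod 6)).comp (AddMonoidHom.snd (ZMod 2) (ZMod 2 × ZMod 6))).prod (((AddMonoidHom.snd (ZMod 2) (ZMod 6)).comp (AddMonoidHom.snd (ZMod 2) (ZMod 2 × ZMod 6))) + ((ZMod.lift 2 ⟨(AddMonoidHom.mulLeft (3 : ZMod 6)).comp (Int.castAddHom (ZMod 6)), by decide⟩)).comp (AddMonoidHom.fst (ZMod 2) (ZMod 2 × ZMod 6))))),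
    ((((AddMonoidHom.fst (ZMod 2) (ZMod 2 × ZMod 6)) + ((ZMod.castHom (show 2 ∣ 6 by norm_num) (ZMod 2)).toAddMonoidHom).comp ((AddMonoidHom.snd (ZMod 2) (ZMod 6)).comp (AddMonoidHom.snd (ZMod 2) (ZMod 2 × ZMod 6)))).prod (((AddMonoidHom.fst (ZMod 2) (ZMod 6)).comp (AddMonoidHom.snd (ZMod 2) (ZMod 2 × ZMod 6))).prod ((AddMonoidHom.snd (ZMod 2) (ZMod 6)).comp (AddMonoidHom.snd (ZMod 2) (ZMod 2 × ZMod 6))))).comp (((AddMonoidHom.fst (ZMod 2) (ZMod 6)).comp (AddMonoidHom.snd (ZMod 2) (ZMod 2 × ZMod 6))).prod ((AddMonoidHom.fst (ZMod 2) (ZMod 2 × ZMod 6)).prod ((AddMonoidHom.snd (ZMod 2) (ZMod 6)).comp (AddMonoidHom.snd (ZMod 2) (ZMod 2 × ZMod 6)))))).comp (AddMonoidHom.mulLeft (((1 : ZMod 2), ((1 : ZMod 2), (5 : ZMod 6))) : ZMod 2 × (ZMod 2 × ZMod 6))),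
    ((((AddMonoidHom.fst (ZMod 2) (ZMod 2 × ZMod 6)) + ((ZMod.castHom (show 2 ∣ 6 by norm_num) (ZMod 2)).toAddMonoidHom).comp ((AddMonoidHom.snd (ZMod 2) (ZMod 6)).comp (AddMonoidHom.snd (ZMod 2) (ZMod 2 × ZMod 6)))).prod (((AddMonoidHom.fst (ZMod 2) (ZMod 6)).comp (AddMonoidHom.snd (ZMod 2) (ZMod 2 × ZMod 6))).prod ((AddMonoidHom.snd (ZMod 2) (ZMod 6)).comp (AddMonoidHom.snd (ZMod 2) (ZMod 2 × ZMod 6))))).comp (((AddMonoidHom.fst (ZMod 2) (ZMod 6)).comp (AddMonoidHom.snd (ZMod 2) (ZMod 2 × ZMod 6))).prod ((AddMonoidHom.fst (ZMod 2) (ZMod 2 × ZMod 6)).prod ((AddMonoidHom.snd (ZMod 2) (ZMod 6)).comp (AddMonoidHom.snd (ZMod 2) (ZMod 2 × ZMod 6)))))).comp (((AddMonoidHom.fst (ZMod 2) (ZMod 2 × ZMod 6)) + ((AddMonoidHom.fst (ZMod 2) (ZMod 6)).comp (AddMonoidHom.snd (ZMod 2) (ZMod 2 × ZMod 6)))).prod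 (((AddMonoidHom.fst (ZMod 2) (ZMod 6)).comp (AddMonoidHom.snd (ZMod 2) (ZMod 2 × ZMod 6))).prod ((AddMonoidHom.snd (ZMod 2) (ZMod 6)).comp (AddMonoidHom.snd (ZMod 2) (ZMod 2 × ZMod 6))))),
    ((((AddMonoidHom.fst (ZMod 2) (ZMod 2 × ZMod 6)) + ((ZMod.castHom (show 2 ∣ 6 by norm_num) (ZMod 2)).toAddMonoidHom).comp ((AddMonoidHom.snd (ZMod 2) (ZMod 6)).comp (AddMonoidHom.snd (ZMod 2) (ZMod 2 × ZMod 6)))).prod (((AddMonoidHom.fst (ZMod 2) (ZMod 6)).comp (AddMonoidHom.snd (ZMod 2) (ZMod 2 × ZMod 6))).prod ((AddMonoidHom.snd (ZMod 2) (ZMod 6)).comp (AddMonoidHom.snd (ZMod 2) (ZMod 2 × ZMod 6))))).comp ((AddMonoidHom.fst (ZMod 2) (ZMod 2 × ZMod 6)).prod (((AddMonoidHom.fst (ZMod 2) (ZMod 6)).comp (AddMonoidHom.snd (ZMod 2) (ZMod 2 × ZMod 6))).prod (((AddMonoidHom.snd (ZMod 2) (ZMod 6)).comp (AddMonoidHom.snd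 (ZMod 2) (ZMod 2 × ZMod 6))) + ((ZMod.lift 2 ⟨(AddMonoidHom.mulLeft (3 : ZMod 6)).comp (Int.castAddHom (ZMod 6)), by decide⟩)).comp (AddMonoidHom.fst (ZMod 2) (ZMod 2 × ZMod 6)))))).comp (AddMonoidHom.mulLeft (((1 : ZMod 2), ((1 : ZMod 2), (5 : ZMod 6))) : ZMod 2 × (ZMod 2 × ZMod 6))),
    ((((AddMonoidHom.fst (ZMod 2) (ZMod 2 × ZMod 6)) + ((ZMod.castHom (show 2 ∣ 6 by norm_num) (ZMod 2)).toAddMonoidHom).comp ((AddMonoidHom.snd (ZMod 2) (ZMod 6)).comp (AddMonoidHom.snd (ZMod 2) (ZMod 2 × ZMod 6)))).prod (((AddMonoidHom.fst (ZMod 2) (ZMod 6)).comp (AddMonoidHom.snd (ZMod 2) (ZMod 2 × ZMod 6))).prod ((AddMonoidHom.snd (ZMod 2) (ZMod 6)).comp (AddMonoidHom.snd (ZMod 2) (ZMod 2 × ZMod 6))))).comp ((AddMonoidHom.fst (ZMod 2) (ZMod 2 × ZMod 6)).prod (((AddMonoidHom.fst (ZMod 2) (ZMod 6)).comp (AddMonoidHom.snd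 (ZMod 2) (ZMod 2 × ZMod 6))).prod (((AddMonoidHom.snd (ZMod 2) (ZMod 6)).comp (AddMonoidHom.snd (ZMod 2) (ZMod 2 × ZMod 6))) + ((ZMod.lift 2 ⟨(AddMonoidHom.mulLeft (3 : ZMod 6)).comp (Int.castAddHom (ZMod 6)), by decide⟩)).comp (AddMonoidHom.fst (ZMod 2) (ZMod 2 × ZMod 6)))))).comp (((AddMonoidHom.fst (ZMod 2) (ZMod 6)).comp (AddMonoidHom.snd (ZMod 2) (ZMod 2 × ZMod 6))).prod ((AddMonoidHom.fst (ZMod 2) (ZMod 2 × ZMod 6)).prod ((AddMonoidHom.snd (ZMod 2) (ZMod 6)).comp (AddMonoidHom.snd (ZMod 2) (ZMod 2 × ZMod 6))))),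
    (((((AddMonoidHom.fst (ZMod 2) (ZMod 2 × ZMod 6)) + ((ZMod.castHom (show 2 ∣ 6 by norm_num) (ZMod 2)).toAddMonoidHom).comp ((AddMonoidHom.snd (ZMod 2) (ZMod 6)).comp (AddMonoidHom.snd (ZMod 2) (ZMod 2 × ZMod 6)))).prod (((AddMonoidHom.fst (ZMod 2) (ZMod 6)).comp (AddMonoidHom.snd (ZMod 2) (ZMod 2 × ZMod 6))).prod ((AddMonoidHom.snd (ZMod 2) (ZMod 6)).comp (AddMonoidHom.snd (ZMod 2) (ZMod 2 × ZMod 6))))).comp (((AddMonoidHom.fst (ZMod 2) (ZMod 6)).comp (AddMonoidHom.snd (ZMod 2) (ZMod 2 × ZMod 6))).prod ((AddMonoidHom.fst (ZMod 2) (ZMod 2 × ZMod 6)).prod ((AddMonoidHom.snd (ZMod 2) (ZMod 6)).comp (AddMonoidHom.snd (ZMod 2) (ZMod 2 × ZMod 6)))))).comp (((AddMonoidHom.fst (ZMod 2) (ZMod 2 × ZMod 6)) + ((AddMonoidHom.fst (ZMod 2) (ZMod 6)).comp (AddMonoidHom.snd (ZMod 2) (ZMod 2 × ZMod 6)))).prod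 (((AddMonoidHom.fst (ZMod 2) (ZMod 6)).comp (AddMonoidHom.snd (ZMod 2) (ZMod 2 × ZMod 6))).prod ((AddMonoidHom.snd (ZMod 2) (ZMod 6)).comp (AddMonoidHom.snd (ZMod 2) (ZMod 2 × ZMod 6)))))).comp (AddMonoidHom.mulLeft (((1 : ZMod 2), ((1 : ZMod 2), (5 : ZMod 6))) : ZMod 2 × (ZMod 2 × ZMod 6))),
    (((((AddMonoidHom.fst (ZMod 2) (ZMod 2 × ZMod 6)) + ((ZMod.castHom (show 2 ∣ 6 by norm_num) (ZMod 2)).toAddMonoidHom).comp ((AddMonoidHom.snd (ZMod 2) (ZMod 6)).comp (AddMonoidHom.snd (ZMod 2) (ZMod 2 × ZMod 6)))).prod (((AddMonoidHom.fst (ZMod 2) (ZMod 6)).comp (AddMonoidHom.snd (ZMod 2) (ZMod 2 × ZMod 6))).prod ((AddMonoidHom.snd (ZMod 2) (ZMod 6)).comp (AddMonoidHom.snd (ZMod 2) (ZMod 2 × ZMod 6))))).comp ((AddMonoidHom.fst (ZMod 2) (ZMod 2 × ZMod 6)).prod (((AddMonoidHom.fst (ZMod 2) (ZMod 6)).comp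 (AddMonoidHom.snd (ZMod 2) (ZMod 2 × ZMod 6))).prod (((AddMonoidHom.snd (ZMod 2) (ZMod 6)).comp (AddMonoidHom.snd (ZMod 2) (ZMod 2 × ZMod 6))) + ((ZMod.lift 2 ⟨(AddMonoidHom.mulLeft (3 : ZMod 6)).comp (Int.castAddHom (ZMod 6)), by decide⟩)).comp (AddMonoidHom.fst (ZMod 2) (ZMod 2 × ZMod 6)))))).comp (((AddMonoidHom.fst (ZMod 2) (ZMod 6)).comp (AddMonoidHom.snd (ZMod 2) (ZMod 2 × ZMod 6))).prod ((AddMonoidHom.fst (ZMod 2) (ZMod 2 × ZMod 6)).prod ((AddMonoidHom.snd (ZMod 2) (ZMod 6)).comp (AddMonoidHom.snd (ZMod 2) (ZMod 2 × ZMod 6)))))).comp (AddMonoidHom.mulLeft (((1 : ZMod 2), ((1 : ZMod 2), (5 : ZMod 6))) : ZMod 2 × (ZMod 2 × ZMod 6))),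
    (((((AddMonoidHom.fst (ZMod 2) (ZMod 2 × ZMod 6)) + ((ZMod.castHom (show 2 ∣ 6 by norm_num) (ZMod 2)).toAddMonoidHom).comp ((AddMonoidHom.snd (ZMod 2) (ZMod 6)).comp (AddMonoidHom.snd (ZMod 2) (ZMod 2 × ZMod 6)))).prod (((AddMonoidHom.fst (ZMod 2) (ZMod 6)).comp (AddMonoidHom.snd (ZMod 2) (ZMod 2 × ZMod 6))).prod ((AddMonoidHom.snd (ZMod 2) (ZMod 6)).comp (AddMonoidHom.snd (ZMod 2) (ZMod 2 × ZMod 6))))).comp ((AddMonoidHom.fst (ZMod 2) (ZMod 2 × ZMod 6)).prod (((AddMonoidHom.fst (ZMod 2) (ZMod 6)).comp (AddMonoidHom.snd (ZMod 2) (ZMod 2 × ZMod 6))).prod (((AddMonoidHom.snd (ZMod 2) (ZMod 6)).comp (AddMonoidHom.snd (ZMod 2) (ZMod 2 × ZMod 6))) + ((ZMod.lift 2 ⟨(AddMonoidHom.mulLeft (3 : ZMod 6)).comp (Int.castAddHom (ZMod 6)), by decide⟩)).comp (AddMonoidHom.fst (ZMod 2) (ZMod 2 × ZMod 6)))))).comp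 (((AddMonoidHom.fst (ZMod 2) (ZMod 6)).comp (AddMonoidHom.snd (ZMod 2) (ZMod 2 × ZMod 6))).prod ((AddMonoidHom.fst (ZMod 2) (ZMod 2 × ZMod 6)).prod ((AddMonoidHom.snd (ZMod 2) (ZMod 6)).comp (AddMonoidHom.snd (ZMod 2) (ZMod 2 × ZMod 6)))))).comp (((AddMonoidHom.fst (ZMod 2) (ZMod 2 × ZMod 6)) + ((AddMonoidHom.fst (ZMod 2) (ZMod 6)).comp (AddMonoidHom.snd (ZMod 2) (ZMod 2 × ZMod 6)))).prod (((AddMonoidHom.fst (ZMod 2) (ZMod 6)).comp (AddMonoidHom.snd (ZMod 2) (ZMod 2 × ZMod 6))).prod ((AddMonoidHom.snd (ZMod 2) (ZMod 6)).comp (AddMonoidHom.snd (ZMod 2) (ZMod 2 × ZMod 6))))),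
    ((((((AddMonoidHom.fst (ZMod 2) (ZMod 2 × ZMod 6)) + ((ZMod.castHom (show 2 ∣ 6 by norm_num) (ZMod 2)).toAddMonoidHom).comp ((AddMonoidHom.snd (ZMod 2) (ZMod 6)).comp (AddMonoidHom.snd (ZMod 2) (ZMod 2 × ZMod 6)))).prod (((AddMonoidHom.fst (ZMod 2) (ZMod 6)).comp (AddMonoidHom.snd (ZMod 2) (ZMod 2 × ZMod 6))).prod ((AddMonoidHom.snd (ZMod 2) (ZMod 6)).comp (AddMonoidHom.snd (ZMod 2) (ZMod 2 × ZMod 6))))).comp ((AddMonoidHom.fst (ZMod 2) (ZMod 2 × ZMod 6)).prod (((AddMonoidHom.fst (ZMod 2) (ZMod 6)).comp (AddMonoidHom.snd (ZMod 2) (ZMod 2 × ZMod 6))).prod (((AddMonoidHom.snd (ZMod 2) (ZMod 6)).comp (AddMonoidHom.snd (ZMod 2) (ZMod 2 × ZMod 6))) + ((ZMod.lift 2 ⟨(AddMonoidHom.mulLeft (3 : ZMod 6)).comp (Int.castAddHom (ZMod 6)), by decide⟩)).comp (AddMonoidHom.fst (ZMod 2) (ZMod 2 × ZMod 6)))))).comp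 (((AddMonoidHom.fst (ZMod 2) (ZMod 6)).comp (AddMonoidHom.snd (ZMod 2) (ZMod 2 × ZMod 6))).prod ((AddMonoidHom.fst (ZMod 2) (ZMod 2 × ZMod 6)).prod ((AddMonoidHom.snd (ZMod 2) (ZMod 6)).comp (AddMonoidHom.snd (ZMod 2) (ZMod 2 × ZMod 6)))))).comp (((AddMonoidHom.fst (ZMod 2) (ZMod 2 × ZMod 6)) + ((AddMonoidHom.fst (ZMod 2) (ZMod 6)).comp (AddMonoidHom.snd (ZMod 2) (ZMod 2 × ZMod 6)))).prod (((AddMonoidHom.fst (ZMod 2) (ZMod 6)).comp (AddMonoidHom.snd (ZMod 2) (ZMod 2 × ZMod 6))).prod ((AddMonoidHom.snd (ZMod 2) (ZMod 6)).comp (AddMonoidHom.snd (ZMod 2) (ZMod 2 × ZMod 6)))))).comp (AddMonoidHom.mulLeft (((1 : ZMod 2), ((1 : ZMod 2), (5 : ZMod 6))) : ZMod 2 × (ZMod 2 × ZMod 6)))]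

/-- The chunks of every representative cover every pair of (first-level, second-level) codes (kernel). -/
theorem P2_2_6k6.cover_chunks : ∀ d ∈ P2_2_6k6.reps, ∀ y₁, y₁ < (prodEnc 2 (prodEnc 2 (zmodEnc 6))).g.n → ∀ y₂, y₂ < (prodEnc 2 (prodEnc 2 (zmodEnc 6))).g.n →
    ∃ e ∈ P2_2_6k6.chunks, e.1 = d ∧ e.2.1.testBit y₁ = false ∧ e.2.2.testBit y₂ = false := by
  decide +kernel

/-- The listed maps are injective (kernel). -/
theorem P2_2_6k6.inj_auts : ∀ f ∈ P2_2_6k6.auts, Function.Injective f := by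
  decide +kernel

/-- Every nonzero element is carried into the representative list by a listed map (kernel). -/
theorem P2_2_6k6.cover_auts : ∀ d : ZMod 2 × (ZMod 2 × ZMod 6), d ≠ 0 → ∃ f ∈ P2_2_6k6.auts, (prodEnc 2 (prodEnc 2 (zmodEnc 6))).enc (f d) ∈ P2_2_6k6.reps := by
  decide +kernel

end STPP211Neg

/-- **`ℤ/2 × ℤ/2 × ℤ/6` admits no STPP family of size pattern `(2,1,1)^6`** (CKSU Def. 5.1, tree `IsSTPP`; kernel search reflected
through `exists_isSTPP_211_iff`).  No `ω` bound follows. [cite: CohnKleinbergSzegedyUmans2005, Def. 5.1] -/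
theorem not_exists_isSTPP_211pow6_z2_z2_z6 : ¬ ∃ A B C : Fin 6 → Finset (ZMod 2 × (ZMod 2 × ZMod 6)), IsSTPP A B C ∧
    ∀ i, (A i).card = 2 ∧ (B i).card = 1 ∧ (C i).card = 1 :=
  STPP211Neg.not_exists_isSTPP_211_of_search2 (STPP211Neg.prodEnc 2 (STPP211Neg.prodEnc 2 (STPP211Neg.zmodEnc 6))) (by decide) STPP211Neg.P2_2_6k6.search_all
    STPP211Neg.P2_2_6k6.cover_chunks STPP211Neg.P2_2_6k6.inj_auts STPP211Neg.P2_2_6k6.cover_auts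

end Summit.MatrixMultiplication.OmegaCensus
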